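import Literature.MathematicalPhysics.QuantumFieldTheory.Balaban1983to89.B9Thm39OneCubeReadingAtLettersY
import Literature.MathematicalPhysics.QuantumFieldTheory.Balaban1983to89.B9Thm31SiteGsqBoundsReg335Y
import Literature.MathematicalPhysics.QuantumFieldTheory.Balaban1983to89.B9Thm311PosViaLocalInversesY

/-!
# `Balaban1983to89.B9Thm39CubeOpsAtLettersY` — [B9] THEOREM 3.9's LOCAL LETTERS AT def-Y's GENUINE CUBE INVERSES: the rows-15–16 walk-letter
# instance `cubeOps39YF` of `B9Thm39WholeBlk.Ops39Blk` with print's local operators `C_□(U) = (Q′G′_□²Q′*)⁻¹_□` built from def-Y's `XY` and `GsqY`,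
# the local-inverse identities `L_□C_□ = I` (Identities395) PROVED at every unitary background, and the N06 certificate's `h348` body
# derived from LOCAL (3.48) + the (2.85)-smallness of (3.95)'s remainder + static cube data

statement-level skeleton of published theorems with citation tags; proofs where landed; nothing here is a claim about the
Yang–Mills mass gap

T. Bałaban, *Propagators for lattice gauge theories in a background field*, Commun. Math. Phys. **99** (1985) 389–434
[`Balaban1985BackgroundPropagators`, "[B9]"]; [4] = T. Bałaban, *Propagators and renormalization transformations for lattice gauge theories. II*,
Commun. Math. Phys. **96** (1984) 223–250 [`Balaban1984PropagatorsII`].  PDF held (`paper:balaban1985-cmp99-background-propagators`, journal page =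
PDF page + 388); pp. 406–413 re-read by this seat (2026-08-28).

THE PRINT (verbatim).  p. 409: *«The operators constructed for this sequence, which we denote by G′_□(U), C_□(U) = (Q′(U)G′_□²(U)Q′\*(U))⁻¹, G_□(U),
satisfy all the inequalities of Theorems 3.1–3.3 correspondingly. … We construct approximations G′₀, C₀, G₀ of the operators G′, (Q′G′²Q′\*)⁻¹, G
taking G′₀ = Σ_{□∈𝒟} h_□G′_□h_□, C₀ = Σ_{□∈𝒟} h_□C_□h_□, …» (3.87); p. 411: *«Q′G′²Q′\*C₀ = I + Σ_□(1 − □̃)Q′G′²Q′\*h_□C_□h_□ + Σ_□ □̃Q′(G′² − G′_□²)Q′\*h_□C_□h_□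
+ Σ_□[□̃Q′G′_□²Q′\*, h_□]C_□h_□ = I − R (3.95). By the same estimates as in [4], especially (2.83)–(2.85), we can see that the operator R is small and
(Q′G′²Q′\*)⁻¹ = C₀(I − R)⁻¹ = Σ_{n=0}^∞ C₀Rⁿ (3.96). The series is convergent in the weighted supremum norm on 𝔅 appearing in the inequality (3.48) in
Theorem 3.2.»*

WHY THIS FILE (cell context, pub-ymgap N06 DAG).  Rows 15–16 of the N06 certificate (this lineage's bundle F5) display ONE analytic binder
`h348 : … Reg335 … U → Conv348Blk (oneCubeOps39YF θ M⋆ 𝔏 bI x) B39 δ39 U` — Theorem 3.2's (3.48) for the GLOBAL `(Q′G′²Q′\*)⁻¹(U)` read on the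
degenerate one-cube letters (g14 `B9Thm39OneCubeReadingAtLettersY`).  Print proves (3.48) by Theorem 3.9's road quoted above, over LOCAL cube inverses;
the typed road (this lineage's g0 `B9Thm39WholeBlk.conv348Blk_of_local348`: `StaticOK39Blk` + `Local348Blk` + `Identities395Blk` + `Small285Blk` +
[4] Lemma 2.1 ⇒ `Conv348Blk`) has so far had no GENUINE multi-cube instance.  node00-def-Y's FILE 35 (`Node00.OpsYLocalInverse`, p605048) made
`G′_□(U) = GsqY i par D U` a genuine letter, so print's `Q′G′_□²Q′\*` IS def-Y's own `XY i par (GsqY i par D) U` (the `Gp` slot of `XY` filled by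
the local inverse) and `C_□(U)` its padded-compression inverse on the cube's blocks — NO new 𝔸-level letter.  This file builds that instance
(`cubeOps39YF`, same pins `blk39F`, `L39` as the one-cube letters, so `Conv348Blk` transfers by g14's `conv348Blk_of_pins`), PROVES the local-inverse
identities at every unitary background (the rows-15–16 analogue of dag-n06-d's (a1): `L_□(U)` is positive definite hence a unit, because
`⟨Ψ, Q′G′_□²Q′\*Ψ⟩_W = ‖G′_□Q′\*Ψ‖²₁` and `G′_□`, `Q′\*` are injective where it matters — this lineage's `isUnit_padDeltaY_parSymY` (p606285) +
dag-n06-w1's `isSymmTr_GsqY_parSymY` (p606956)), and derives the displayed `h348` body from the two LOCAL analytic schemas + static cube data.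

WHAT IS DEFINED ∕ PROVED (sorry-free; definitions with bodies: `blkIndY`, `Lloc39`, `Cl39`, `CubeData39`, `cubeOps39YF`; every clause of [B9] that
is an estimate stays a hypothesis schema).
* §1 (𝔸-level, `M_N(ℂ)` fibres) `posDefTr_dirPadY_cutMulY_of_pos_on_range` (any carrier: the padded compression `M_χ T M_χ + 1 − M_χ` is `PosDefTr` as
  soon as `T` is positive ON THE RANGE of the 0∕1 cut-off), `inverse_comm_of_comm`, `GsqY_apply_of_support` (`P_Dψ = ψ ⇒ G′_□(U)ψ = (padΔ)⁻¹ψ`),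
  `GsqY_apply_ne_zero_of_support`, `cubeProjY_QpsY_cutMulY` (Q′\*(U) of a block function living on blocks whose sites lie in `D` is supported in `D`),
  ★ `trIP_XY_GsqY_parSymY_eq` (`⟨Ψ, X_□(U)Ψ⟩_W = ⟨G′_□Q′\*Ψ, G′_□Q′\*Ψ⟩₁`), ★★ `trIP_XY_GsqY_parSymY_pos` (positivity on the cube's block functions),
  ★★ `posDefTr_padX_parSymY` ∕ `isUnit_padX_parSymY` — the padded compression of `X_□(U) = Q′G′_□²Q′\*(U)` to the cube's blocks is positive definite
  and a unit at EVERY `G`-valued `U`, `G ≤ U(N)` (regime-free).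
* §2 the realified local letters on g14's carrier `X39 = BlkY × κ39`: `blkIndY` (0∕1 block indicator), ★ `Lloc39 i parS D Dblk U := realify39 basis39
  (unit39 • dirPadY (M_{𝟙_Dblk}) (XY i parS (GsqY i parS D) U))` (g14's `L39` normalisation), `Cl39 := Ring.inverse (Lloc39 …)`; `isUnit_realify39`,
  `isUnit_smul_of_ne_zero`, ★★ `isUnit_Lloc39_parSymY`, `Lloc39_mul_Cl39_parSymY` (`L_□C_□ = 1`).
* §3 `CubeData39 x` (the cube letters as PARAMETERS: site sets `D c` (□̃), block sets `Dblk c`, block cut-offs `hB c`, observation sets `S c` — W-a's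
  `cubeDomY ∕ cubeBlksY ∕ hWalkY ∕ SblkY` instantiate them) and ★ **`cubeOps39YF θ M⋆ 𝔏 bI 𝒞 x : Ops39Blk (geo9Y x) (bg9Y …) (X39 …) ι Unit`** (pins
  `blk := blk39F … (bI x)`, `L := L39 …` — literally those of `oneCubeOps39YF`; `h c p := hB c p.1`, `chi c p := 𝟙_{Dblk c} p.1`, `Lloc ∕ Cl` of §2 at
  `(𝔏 x).parS`; one factor index with `R′ := 0` — the factors of (3.97)–(3.99) are not needed for (3.96)); `cubeOps39YF_blk ∕ _L ∕ _Lloc ∕ _Cl` (rfl);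
  ★★★ **`identities395Blk_cubeOps39YF`**: `Identities395Blk (cubeOps39YF …) U` at every `G`-valued `U` under the transporter pin `(𝔏 x).parS = parSymY`
  and the inclusion «sites of `Dblk c` ⊆ `D c`» — ZERO analytic input.
* §4 ★★★ THE FACE **`display348_of_local348_small285`**: for a `G`-valued `U` (`G ≤ U(N)`), static data `StaticOK39Blk (cubeOps39YF …) Ncnt`, [4] Lemma 2.1
  `Ineq261With c′ (b6 (geo9Y x)) r α′`, LOCAL (3.48) `Local348Blk (cubeOps39YF …) B₀ δ₀ U`, the (2.85)-smallness `Small285Blk (cubeOps39YF …) θ₀ r U` and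
  «M sufficiently large» `2θ₀c′ ≤ (geo9Y x).M` ⇒ **`Conv348Blk (oneCubeOps39YF θ M⋆ 𝔏 bI x) (2(Ncnt·B₀)c′) ((1 − α′)r) U`** — the displayed `h348` body
  (g0 `conv348Blk_of_local348` at the genuine instance + §3 + g14 `conv348Blk_of_pins`).

HONEST SCOPE.  (i) `Local348Blk` (Theorem 3.2 for the LOCAL `C_□(U)`: Cor. 3.6, Sect. B at the local operators) and `Small285Blk` ([4] (2.83)–(2.85) for
(3.95)'s `R`, from Theorem 3.1's local bounds) are the analytic content and stay HYPOTHESES; `StaticOK39Blk` is geometric∕partition data of the chosen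
cubes (inhabitable by W-a-type constructions, not built here).  (ii) The local operator is the padded compression to the cube's BLOCKS of def-Y's `XY`
with `Gp := GsqY … (D c)` (the compression of the GLOBAL `Δ′_a(U)` to □̃, FILE 35's model of (3.79)); print's `C_□` is built on the local sequence
`{Ω_n(□)}` — the same operator up to the boundary convention recorded in FILE 35.  (iii) One factor index, `R′ := 0`: the re-localised factors
(3.97)–(3.99) serve the random-walk STRUCTURE (Cor. 3.8-type localisation), not the kernel bound (3.96) ⇒ (3.48), and are not modelled.  (iv) `𝔸 =
M_N(ℂ)`, `G ≤ U(N)`; §3–§4 at a member `x` of def-Y's family with letters `𝔏` pinned to `parSymY` on the `parS` slot.  Count-neutral (no new named fact;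
N06 NOT discharged; `h348` stays displayed until the knit decides otherwise); nothing continuum, nothing about OS axioms or the mass gap.  No `sorry`, no
`axiom`, no `instance`, no `notation`.  Seat `pub-ymgap-dag-n06-j` (bundle F5, rows 15–17), gen 20, 2026-08-28; NEW file; modifies nothing.
-/

noncomputable section

namespace Literature.MathematicalPhysics.QuantumFieldTheory.Balaban1983to89.B9Thm39CubeOpsAtLettersY

open Finset B6RandomWalk B9Thm37Sum B9Thm34Ext B9Thm39Whole B9Thm39WholeBlk B9Thm39ReadingCoords B9Thm39ReadingAtLetters
  B9Thm39OneCubeReadingAtLettersY B9Thm311ReadingCoords B9Thm311DeltaPrimePos B9Thm311LocalInversePosY B9Thm311PosViaLocalInversesY Node00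
  Node00.OpsYLocalInverse
open B9Ineq349SiteFromConv348 (blk39F)
open B9Thm37CubeCoverCommutators (cutMulY cutMulY_apply cutMulY_mul cutMulY_one)
open B9Thm311ReadingAtLetters (wB wB_pos)
open B9Thm311AdjointAtLetters (QpsY_apply_eq qpsY_injective)
open B9Thm311SymmAtRecordV4 (adj_parSymY)
open B9Thm31SiteGsqBoundsReg335Y (isSymmTr_GsqY_parSymY)
open B9Ineq349SiteAdjoint (trIP_comm)
open B6Lemma21Repaired (Ineq261With)
open B6KLevelCensusIndexV1 B6Geom246MultiLevelBox B9PinMembersKLevelV1 B9PinCarriersKLevelV1 B9PinGeometryKLevelV1 B7Prop2SpecialUnitary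
open scoped Matrix Matrix.Norms.L2Operator

/-! ## §1 The local operator `X_□(U) = Q′G′_□²Q′*(U)` at def-Y's letters: positivity on the cube's blocks, at every unitary background -/

section Generic

variable {X : Type} [Fintype X] {N : ℕ}

/-- the padded compression `M_χ T M_χ + 1 − M_χ` by a 0∕1 cut-off is POSITIVE DEFINITE as soon as `T` is positive ON THE RANGE of `M_χ`:
`∀ Φ, M_χΦ ≠ 0 → 0 < ⟨M_χΦ, T M_χΦ⟩_w` (any carrier, any weight `w > 0`). [cite: Balaban1985BackgroundPropagators, (3.79) p.406 + Thm 3.11 p.416, bookkeeping] -/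
theorem posDefTr_dirPadY_cutMulY_of_pos_on_range {w : X → ℝ} (hw : ∀ s, 0 < w s) {χ : X → ℝ} (hχ : ∀ z, χ z = 0 ∨ χ z = 1)
    {T : Module.End ℂ (X → Matrix (Fin N) (Fin N) ℂ)}
    (hT : ∀ Φ : X → Matrix (Fin N) (Fin N) ℂ, cutMulY χ Φ ≠ 0 → 0 < trIP w (cutMulY χ Φ) (T (cutMulY χ Φ))) :
    PosDefTr w (dirPadY (cutMulY χ) T) := by
  intro Φ hΦ
  rw [trIP_dirPadY_cutMulY_eq w hχ]
  by_cases hP : cutMulY χ Φ = 0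
  · have hrest : cutMulY (fun z => 1 - χ z) Φ = Φ := by
      have := cutMulY_add_compl (N := N) χ Φ
      rwa [hP, zero_add] at this
    rw [hP, map_zero, trIP_zero_right, zero_add, hrest]
    exact trIP_self_pos w hw hΦ
  · exact add_pos_of_pos_of_nonneg (hT _ hP) (trIP_self_nonneg w hw _)

/-- an operator commuting with a unit commutes with its inverse. [cite: Balaban1985BackgroundPropagators, (3.79) p.406, bookkeeping] -/
theorem inverse_comm_of_comm {A : Type} [Ring A] {P u : A} (hu : IsUnit u) (h : P * u = u * P) :
    P * Ring.inverse u = Ring.inverse u * P := by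
  calc P * Ring.inverse u = Ring.inverse u * u * P * Ring.inverse u := by rw [Ring.inverse_mul_cancel u hu, one_mul]
    _ = Ring.inverse u * (P * u) * Ring.inverse u := by rw [mul_assoc (Ring.inverse u) u P, h]
    _ = Ring.inverse u * P * (u * Ring.inverse u) := by noncomm_ring
    _ = Ring.inverse u * P := by rw [Ring.mul_inverse_cancel u hu, mul_one]

end Generic

section Letters

variable {d ℓ : ℕ} {hd : 1 ≤ d + 1} {hL : Odd (ℓ + 1) ∧ 1 < ℓ + 1} {b₀ b₁ : ℝ} {N : ℕ}
variable (i : KIdx d ℓ hd hL b₀ b₁) {G : Subgroup (Matrix (Fin N) (Fin N) ℂ)ˣ}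

/-- the cube projection commutes with the padded compression: `P_D (P_DΔ′P_D + 1 − P_D) = (P_DΔ′P_D + 1 − P_D) P_D`.
[cite: Balaban1985BackgroundPropagators, (3.79) p.406, bookkeeping] -/
theorem cubeProjY_comm_padDeltaY (par : SiteParY (Matrix (Fin N) (Fin N) ℂ) i) (D : Finset (SiteY i)) (U : CfgY (Matrix (Fin N) (Fin N) ℂ) i) :
    cubeProjY i D * padDeltaY i par D U = padDeltaY i par D U * cubeProjY i D := by
  rw [padDeltaY, mul_dirPadY (cubeProjY_mul_cubeProjY i D), dirPadY_mul (cubeProjY_mul_cubeProjY i D)]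

/-- ★ on functions SUPPORTED IN □̃ the local inverse IS the inverse of the padded compression: `P_Dψ = ψ ⇒ G′_□(U)ψ = (padΔ)⁻¹ψ`.
[cite: Balaban1985BackgroundPropagators, (3.79) p.406, (3.25) p.395] -/
theorem GsqY_apply_of_support (par : SiteParY (Matrix (Fin N) (Fin N) ℂ) i) {D : Finset (SiteY i)} {U : CfgY (Matrix (Fin N) (Fin N) ℂ) i}
    (hU : IsUnit (padDeltaY i par D U)) {ψ : SiteY i → Matrix (Fin N) (Fin N) ℂ} (hψ : cubeProjY i D ψ = ψ) :
    GsqY i par D U ψ = Ring.inverse (padDeltaY i par D U) ψ := by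
  have hcomm := inverse_comm_of_comm hU (cubeProjY_comm_padDeltaY i par D U)
  rw [GsqY_def, Module.End.mul_apply, Module.End.mul_apply, hψ, ← Module.End.mul_apply, hcomm, Module.End.mul_apply, hψ]

/-- hence `G′_□(U)` is injective on the functions supported in □̃. [cite: Balaban1985BackgroundPropagators, (3.79) p.406, (3.25) p.395] -/
theorem GsqY_apply_ne_zero_of_support (par : SiteParY (Matrix (Fin N) (Fin N) ℂ) i) {D : Finset (SiteY i)} {U : CfgY (Matrix (Fin N) (Fin N) ℂ) i}
    (hU : IsUnit (padDeltaY i par D U)) {ψ : SiteY i → Matrix (Fin N) (Fin N) ℂ} (hψ : cubeProjY i D ψ = ψ) (hne : ψ ≠ 0) :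
    GsqY i par D U ψ ≠ 0 := by
  rw [GsqY_apply_of_support i par hU hψ]
  intro h0
  apply hne
  have := apply_inverse_of_isUnit hU ψ
  rw [h0, map_zero] at this
  exact this.symm

open Classical in
/-- the 0∕1 indicator of a block set. [cite: Balaban1985BackgroundPropagators, (3.87) p.409 (□ as a set of blocks), dictionary] -/
def blkIndY (Dblk : Finset (BlkY i)) : BlkY i → ℝ := fun s => if s ∈ Dblk then 1 else 0

open Classical in
/-- the indicator is 0∕1-valued. [cite: Balaban1985BackgroundPropagators, (3.87) p.409, bookkeeping] -/
theorem blkIndY_zero_one (Dblk : Finset (BlkY i)) (s : BlkY i) : blkIndY i Dblk s = 0 ∨ blkIndY i Dblk s = 1 := by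
  unfold blkIndY
  split_ifs <;> simp

open Classical in
/-- ★ Q′\*(U) of a block function cut off to blocks whose sites all lie in `D` is supported in `D`.
[cite: Balaban1985BackgroundPropagators, (3.19) p.393 (Q′ reads a site through its own block), (3.79) p.406] -/
theorem cubeProjY_QpsY_cutMulY (par : SiteParY (Matrix (Fin N) (Fin N) ℂ) i) (U : CfgY (Matrix (Fin N) (Fin N) ℂ) i)
    {D : Finset (SiteY i)} {Dblk : Finset (BlkY i)} (hDD : ∀ z : SiteY i, blkOf i.D.toDomains z ∈ Dblk → z ∈ D)
    (Ψ : BlkY i → Matrix (Fin N) (Fin N) ℂ) :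
    cubeProjY i D (QpsY i par U (cutMulY (blkIndY i Dblk) Ψ)) = QpsY i par U (cutMulY (blkIndY i Dblk) Ψ) := by
  funext z
  rw [cubeProjY_apply]
  split_ifs with hz
  · rfl
  · rw [QpsY_apply_eq, cutMulY_apply, blkIndY]
    have hs : blkOf i.D.toDomains z ∉ Dblk := fun h => hz (hDD z h)
    rw [if_neg hs]
    simp

/-- ★ **THE FORM OF THE LOCAL OPERATOR**: `⟨Ψ, Q′G′_□²Q′\*(U)Ψ⟩_W = ⟨G′_□(U)Q′\*(U)Ψ, G′_□(U)Q′\*(U)Ψ⟩₁` at every `G`-valued `U`, `G ≤ U(N)` (Q′\* the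
W-adjoint of Q′, G′_□ symmetric). [cite: Balaban1985BackgroundPropagators, (3.87) p.409, p.393 (scalar products); Balaban1984PropagatorsI, p.25 («⟨ω, Q′G′²Q′\*ω⟩ = ‖G′Q′\*ω‖²»)] -/
theorem trIP_XY_GsqY_parSymY_eq (hG : G ≤ B7Prop2Explicit.unitaryUnits (Matrix (Fin N) (Fin N) ℂ))
    {U : CfgY (Matrix (Fin N) (Fin N) ℂ) i} (hU : ∀ μ x, U μ x ∈ G) (D : Finset (SiteY i)) (Ψ : BlkY i → Matrix (Fin N) (Fin N) ℂ) :
    trIP (wB i) Ψ (XY i (parSymY i) (GsqY i (parSymY i) D) U Ψ)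
      = trIP (fun _ => (1 : ℝ)) (GsqY i (parSymY i) D U (QpsY i (parSymY i) U Ψ)) (GsqY i (parSymY i) D U (QpsY i (parSymY i) U Ψ)) := by
  have hX : XY i (parSymY i) (GsqY i (parSymY i) D) U Ψ
      = QpY i (parSymY i) U (GsqY i (parSymY i) D U (GsqY i (parSymY i) D U (QpsY i (parSymY i) U Ψ))) := rfl
  rw [hX, trIP_comm, adj_parSymY i hG hU, isSymmTr_GsqY_parSymY i hG hU D]

/-- ★★ **POSITIVITY ON THE CUBE's BLOCK FUNCTIONS**: for a block function `Φ = 𝟙_{Dblk}Ψ ≠ 0` living on blocks whose sites lie in □̃ = `D`,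
`0 < ⟨Φ, Q′G′_□²Q′\*(U)Φ⟩_W` — at EVERY `G`-valued `U`, `G ≤ U(N)`, no regularity. [cite: Balaban1985BackgroundPropagators, Thm 3.11 p.416 («obvious for the first three operators»), (3.87) p.409] -/
theorem trIP_XY_GsqY_parSymY_pos (hG : G ≤ B7Prop2Explicit.unitaryUnits (Matrix (Fin N) (Fin N) ℂ))
    {U : CfgY (Matrix (Fin N) (Fin N) ℂ) i} (hU : ∀ μ x, U μ x ∈ G) {D : Finset (SiteY i)} {Dblk : Finset (BlkY i)}
    (hDD : ∀ z : SiteY i, blkOf i.D.toDomains z ∈ Dblk → z ∈ D) {Ψ : BlkY i → Matrix (Fin N) (Fin N) ℂ}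
    (hΨ : cutMulY (blkIndY i Dblk) Ψ ≠ 0) :
    0 < trIP (wB i) (cutMulY (blkIndY i Dblk) Ψ) (XY i (parSymY i) (GsqY i (parSymY i) D) U (cutMulY (blkIndY i Dblk) Ψ)) := by
  rw [trIP_XY_GsqY_parSymY_eq i hG hU]
  refine trIP_self_pos _ (fun _ => one_pos) ?_
  refine GsqY_apply_ne_zero_of_support i (parSymY i) (isUnit_padDeltaY_parSymY i hG hU D)
    (cubeProjY_QpsY_cutMulY i (parSymY i) U hDD Ψ) ?_
  intro h0
  exact hΨ (qpsY_injective i (parSymY i) U (by rw [h0, map_zero]))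

/-- ★★ **THE PADDED COMPRESSION OF `Q′G′_□²Q′\*(U)` TO THE CUBE's BLOCKS IS POSITIVE DEFINITE** (block weight `W`) at every `G`-valued `U`, `G ≤ U(N)`.
[cite: Balaban1985BackgroundPropagators, (3.87) p.409 (C_□ = (Q′G′_□²Q′\*)⁻¹), Thm 3.11 p.416] -/
theorem posDefTr_padX_parSymY (hG : G ≤ B7Prop2Explicit.unitaryUnits (Matrix (Fin N) (Fin N) ℂ))
    {U : CfgY (Matrix (Fin N) (Fin N) ℂ) i} (hU : ∀ μ x, U μ x ∈ G) {D : Finset (SiteY i)} {Dblk : Finset (BlkY i)}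
    (hDD : ∀ z : SiteY i, blkOf i.D.toDomains z ∈ Dblk → z ∈ D) :
    PosDefTr (wB i) (dirPadY (cutMulY (blkIndY i Dblk)) (XY i (parSymY i) (GsqY i (parSymY i) D) U)) :=
  posDefTr_dirPadY_cutMulY_of_pos_on_range (wB_pos i) (blkIndY_zero_one i Dblk) fun _ hΨ =>
    trIP_XY_GsqY_parSymY_pos i hG hU hDD hΨ

/-- hence a UNIT of `End_ℂ(BlkY → M_N(ℂ))`. [cite: Balaban1985BackgroundPropagators, (3.87) p.409, (3.25) p.395] -/
theorem isUnit_padX_parSymY (hG : G ≤ B7Prop2Explicit.unitaryUnits (Matrix (Fin N) (Fin N) ℂ))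
    {U : CfgY (Matrix (Fin N) (Fin N) ℂ) i} (hU : ∀ μ x, U μ x ∈ G) {D : Finset (SiteY i)} {Dblk : Finset (BlkY i)}
    (hDD : ∀ z : SiteY i, blkOf i.D.toDomains z ∈ Dblk → z ∈ D) :
    IsUnit (dirPadY (cutMulY (blkIndY i Dblk)) (XY i (parSymY i) (GsqY i (parSymY i) D) U)) :=
  isUnit_of_posDefTr (posDefTr_padX_parSymY i hG hU hDD)

end Letters

/-! ## §2 The realified local letters `L_□(U)`, `C_□(U)` on the carrier `X39 = 𝔅 × κ39` -/

section Real

variable {d ℓ : ℕ} {hd : 1 ≤ d + 1} {hL : Odd (ℓ + 1) ∧ 1 < ℓ + 1} {b₀ b₁ : ℝ} {N : ℕ}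
variable (i : KIdx d ℓ hd hL b₀ b₁) {G : Subgroup (Matrix (Fin N) (Fin N) ℂ)ˣ}

/-- ★ **THE LOCAL OPERATOR LETTER `L_□(U)`** in print's units and real coordinates: g14's normalisation `unit39` and chart `realify39 basis39` applied to the
padded compression of `Q′G′_□²Q′\*(U)` to the cube's blocks `Dblk` (`G′_□` the local inverse on the cube's sites `D`).
[cite: Balaban1985BackgroundPropagators, (3.87) p.409, (3.95) p.411 (the letter □̃Q′G′_□²Q′\*), Thm 3.2 p.398 (units)] -/
def Lloc39 (parS : SiteParY (Matrix (Fin N) (Fin N) ℂ) i) (D : Finset (SiteY i)) (Dblk : Finset (BlkY i))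
    (U : CfgY (Matrix (Fin N) (Fin N) ℂ) i) : Module.End ℝ (X39 (Matrix (Fin N) (Fin N) ℂ) i → ℝ) :=
  realify39 (basis39 (Matrix (Fin N) (Fin N) ℂ))
    (((unit39 i : ℝ) : ℂ) • dirPadY (cutMulY (blkIndY i Dblk)) (XY i parS (GsqY i parS D) U))

/-- ★ **THE LOCAL INVERSE LETTER `C_□(U) = (Q′G′_□²Q′\*)⁻¹_□`**: `Ring.inverse` of `L_□(U)` (the genuine two-sided inverse where `L_□(U)` is a unit — at every
unitary background, below — and `0` otherwise). [cite: Balaban1985BackgroundPropagators, (3.87) p.409 (C_□), (3.96) p.411] -/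
def Cl39 (parS : SiteParY (Matrix (Fin N) (Fin N) ℂ) i) (D : Finset (SiteY i)) (Dblk : Finset (BlkY i))
    (U : CfgY (Matrix (Fin N) (Fin N) ℂ) i) : Module.End ℝ (X39 (Matrix (Fin N) (Fin N) ℂ) i → ℝ) :=
  Ring.inverse (Lloc39 i parS D Dblk U)

/-- `realify39` carries units to units (it is multiplicative and unital). [cite: Balaban1985BackgroundPropagators, p.389, bookkeeping] -/
theorem isUnit_realify39 {𝔸 : Type} [NormedRing 𝔸] [NormedAlgebra ℂ 𝔸] {S κ : Type} [Fintype κ]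
    (b : Module.Basis κ ℝ 𝔸) {O : (S → 𝔸) →ₗ[ℂ] (S → 𝔸)} (hO : IsUnit O) :
    IsUnit (realify39 b O) := by
  obtain ⟨u, rfl⟩ := hO
  refine ⟨⟨realify39 b (u : (S → 𝔸) →ₗ[ℂ] (S → 𝔸)), realify39 b (↑u⁻¹ : (S → 𝔸) →ₗ[ℂ] (S → 𝔸)), ?_, ?_⟩, rfl⟩
  · rw [← realify39_mul, Units.mul_inv, realify39_one]
  · rw [← realify39_mul, Units.inv_mul, realify39_one]

/-- a non-zero scalar multiple of a unit of `End_ℂ` is a unit. [cite: Balaban1985BackgroundPropagators, Thm 3.2 p.398 (units), bookkeeping] -/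
theorem isUnit_smul_of_ne_zero {V : Type} [AddCommGroup V] [Module ℂ V] {c : ℂ} (hc : c ≠ 0) {O : Module.End ℂ V} (hO : IsUnit O) :
    IsUnit (c • O) := by
  rw [Algebra.smul_def]
  exact ((IsUnit.mk0 c hc).map (algebraMap ℂ (Module.End ℂ V))).mul hO

/-- ★★ **`L_□(U)` IS A UNIT AT EVERY `G`-VALUED `U`**, `G ≤ U(N)`, for every cube whose blocks' sites lie in its site set (`parS = parSymY`).
[cite: Balaban1985BackgroundPropagators, (3.87) p.409, Thm 3.11 p.416] -/
theorem isUnit_Lloc39_parSymY (hG : G ≤ B7Prop2Explicit.unitaryUnits (Matrix (Fin N) (Fin N) ℂ))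
    {U : CfgY (Matrix (Fin N) (Fin N) ℂ) i} (hU : ∀ μ x, U μ x ∈ G) {D : Finset (SiteY i)} {Dblk : Finset (BlkY i)}
    (hDD : ∀ z : SiteY i, blkOf i.D.toDomains z ∈ Dblk → z ∈ D) : IsUnit (Lloc39 i (parSymY i) D Dblk U) :=
  isUnit_realify39 _ (isUnit_smul_of_ne_zero (by exact_mod_cast (unit39_pos i).ne') (isUnit_padX_parSymY i hG hU hDD))

/-- ★ **THE LOCAL-INVERSE IDENTITY `L_□(U)C_□(U) = 1`** at every `G`-valued `U`. [cite: Balaban1985BackgroundPropagators, (3.87) p.409, (3.95) p.411] -/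
theorem Lloc39_mul_Cl39_parSymY (hG : G ≤ B7Prop2Explicit.unitaryUnits (Matrix (Fin N) (Fin N) ℂ))
    {U : CfgY (Matrix (Fin N) (Fin N) ℂ) i} (hU : ∀ μ x, U μ x ∈ G) {D : Finset (SiteY i)} {Dblk : Finset (BlkY i)}
    (hDD : ∀ z : SiteY i, blkOf i.D.toDomains z ∈ Dblk → z ∈ D) :
    Lloc39 i (parSymY i) D Dblk U * Cl39 i (parSymY i) D Dblk U = 1 :=
  Ring.mul_inverse_cancel _ (isUnit_Lloc39_parSymY i hG hU hDD)

/-- and `C_□(U)L_□(U) = 1`. [cite: Balaban1985BackgroundPropagators, (3.87) p.409, (3.95) p.411] -/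
theorem Cl39_mul_Lloc39_parSymY (hG : G ≤ B7Prop2Explicit.unitaryUnits (Matrix (Fin N) (Fin N) ℂ))
    {U : CfgY (Matrix (Fin N) (Fin N) ℂ) i} (hU : ∀ μ x, U μ x ∈ G) {D : Finset (SiteY i)} {Dblk : Finset (BlkY i)}
    (hDD : ∀ z : SiteY i, blkOf i.D.toDomains z ∈ Dblk → z ∈ D) :
    Cl39 i (parSymY i) D Dblk U * Lloc39 i (parSymY i) D Dblk U = 1 :=
  Ring.inverse_mul_cancel _ (isUnit_Lloc39_parSymY i hG hU hDD)

end Real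

/-! ## §3 The multi-cube letter record `cubeOps39YF` and its local-inverse identities -/

section Instance

open scoped Matrix.Norms.L2Operator
open B9Thm39ReadingFaithful B6GlobalChartV1 B6Ineq2142KLevelV1

variable {N : ℕ} (θ : Stage3Params) (Mstar : ℕ) (𝔏 : LettersY N θ Mstar)
variable [∀ x : MemberY θ.d₆ θ.ℓ₆ θ.hd' θ.hL' θ.b₀ θ.b₁ Mstar, Fintype (geo9Y x).Site]
  [∀ x : MemberY θ.d₆ θ.ℓ₆ θ.hd' θ.hL' θ.b₀ θ.b₁ Mstar, DecidableEq (geo9Y x).Site]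
variable (bI : ∀ x : MemberY θ.d₆ θ.ℓ₆ θ.hd' θ.hL' θ.b₀ θ.b₁ Mstar, FBondY x.toKIdx → IBondY x.toKIdx)

/-- **THE CUBE LETTERS OF A MEMBER AS PARAMETERS** (print's family 𝒟 of cubes □ with □̃, h_□, and the observation sets): for each cube index `c : ι`, the
site set `D c` (□̃ as sites — the domain of `G′_□`), the block set `Dblk c` (□̃ as blocks — the domain of `C_□`), the block cut-off `hB c` (h_□ on 𝔅) and the
observation set `S c ⊇ supp h_□` in the geometry.  Data only; the partition ∕ overlap ∕ inclusion properties are the static binder `StaticOK39Blk` and `hDD`.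
[cite: Balaban1985BackgroundPropagators, p.408 (𝒟, □̃, h_□, «Σ h_□² = 1»), (3.87) p.409, dictionary] -/
structure CubeData39 (ι : Type) (x : MemberY θ.d₆ θ.ℓ₆ θ.hd' θ.hL' θ.b₀ θ.b₁ Mstar) where
  D : ι → Finset (SiteY x.toKIdx)
  Dblk : ι → Finset (BlkY x.toKIdx)
  hB : ι → BlkY x.toKIdx → ℝ
  S : ι → Finset (geo9Y x).Site

variable {θ Mstar}
variable {ι : MemberY θ.d₆ θ.ℓ₆ θ.hd' θ.hL' θ.b₀ θ.b₁ Mstar → Type}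

omit [∀ x : MemberY θ.d₆ θ.ℓ₆ θ.hd' θ.hL' θ.b₀ θ.b₁ Mstar, DecidableEq (geo9Y x).Site] in
/-- ★ **THE MULTI-CUBE LETTER RECORD OF THEOREM 3.9 AT def-Y's LETTERS** on the faithful block map: the pinned fields `blk := blk39F … (bI x)`, `L := L39 …`
are LITERALLY those of `oneCubeOps39YF`; `h_□`, `□̃ = 𝟙_{Dblk}` from the cube data; `L_□ ∕ C_□` the realified local letters of §2 at `(𝔏 x).parS`; one
factor index with `R′ := 0` (the factors of (3.97)–(3.99) are not needed for (3.96)).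
[cite: Balaban1985BackgroundPropagators, (3.87) p.409 + (3.95)–(3.96) p.411 + Thm 3.9 p.413] -/
def cubeOps39YF (𝒞 : ∀ x, CubeData39 θ Mstar (ι x) x) (x : MemberY θ.d₆ θ.ℓ₆ θ.hd' θ.hL' θ.b₀ θ.b₁ Mstar) :
    Ops39Blk (geo9Y x) (bg9Y (Matrix (Fin N) (Fin N) ℂ) (specialUnitaryUnits (Fin N)) x) (X39 (Matrix (Fin N) (Fin N) ℂ) x.toKIdx) (ι x) Unit where
  blk := blk39F (Matrix (Fin N) (Fin N) ℂ) x.toKIdx (bI x)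
  S := (𝒞 x).S
  h := fun c p => (𝒞 x).hB c p.1
  chi := fun c p => blkIndY x.toKIdx ((𝒞 x).Dblk c) p.1
  L := L39 x.toKIdx (𝔏 x).parS (𝔏 x).Gp
  Lloc := fun U c => Lloc39 x.toKIdx (𝔏 x).parS ((𝒞 x).D c) ((𝒞 x).Dblk c) U
  Cl := fun U c => Cl39 x.toKIdx (𝔏 x).parS ((𝒞 x).D c) ((𝒞 x).Dblk c) U
  Sw := fun _ => ∅
  Rw := fun _ _ => 0

variable (𝒞 : ∀ x, CubeData39 θ Mstar (ι x) x)

omit [∀ x : MemberY θ.d₆ θ.ℓ₆ θ.hd' θ.hL' θ.b₀ θ.b₁ Mstar, DecidableEq (geo9Y x).Site] in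
/-- the block-map pin: the same `blk39F` as the one-cube letters (`rfl`). [cite: Balaban1984PropagatorsII, p.248 («sites replaced by bonds»), bookkeeping] -/
theorem cubeOps39YF_blk (x : MemberY θ.d₆ θ.ℓ₆ θ.hd' θ.hL' θ.b₀ θ.b₁ Mstar) :
    (cubeOps39YF 𝔏 bI 𝒞 x).blk = (oneCubeOps39YF θ Mstar 𝔏 bI x).blk := rfl

omit [∀ x : MemberY θ.d₆ θ.ℓ₆ θ.hd' θ.hL' θ.b₀ θ.b₁ Mstar, DecidableEq (geo9Y x).Site] in
/-- the operator pin: the same GLOBAL `L39 = Q′G′²Q′*(U)` as the one-cube letters (`rfl`). [cite: Balaban1985BackgroundPropagators, Thm 3.2 p.398, bookkeeping] -/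
theorem cubeOps39YF_L (x : MemberY θ.d₆ θ.ℓ₆ θ.hd' θ.hL' θ.b₀ θ.b₁ Mstar) :
    (cubeOps39YF 𝔏 bI 𝒞 x).L = (oneCubeOps39YF θ Mstar 𝔏 bI x).L := rfl

omit [∀ x : MemberY θ.d₆ θ.ℓ₆ θ.hd' θ.hL' θ.b₀ θ.b₁ Mstar, Fintype (geo9Y x).Site]
  [∀ x : MemberY θ.d₆ θ.ℓ₆ θ.hd' θ.hL' θ.b₀ θ.b₁ Mstar, DecidableEq (geo9Y x).Site] in
/-- the local letter, unfolded (`rfl`). [cite: Balaban1985BackgroundPropagators, (3.87) p.409, bookkeeping] -/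
theorem cubeOps39YF_Lloc (x : MemberY θ.d₆ θ.ℓ₆ θ.hd' θ.hL' θ.b₀ θ.b₁ Mstar)
    (U : (bg9Y (Matrix (Fin N) (Fin N) ℂ) (specialUnitaryUnits (Fin N)) x).Cfg) (c : ι x) :
    (cubeOps39YF 𝔏 bI 𝒞 x).Lloc U c = Lloc39 x.toKIdx (𝔏 x).parS ((𝒞 x).D c) ((𝒞 x).Dblk c) U := rfl

omit [∀ x : MemberY θ.d₆ θ.ℓ₆ θ.hd' θ.hL' θ.b₀ θ.b₁ Mstar, Fintype (geo9Y x).Site]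
  [∀ x : MemberY θ.d₆ θ.ℓ₆ θ.hd' θ.hL' θ.b₀ θ.b₁ Mstar, DecidableEq (geo9Y x).Site] in
/-- the local inverse letter, unfolded (`rfl`). [cite: Balaban1985BackgroundPropagators, (3.87) p.409, bookkeeping] -/
theorem cubeOps39YF_Cl (x : MemberY θ.d₆ θ.ℓ₆ θ.hd' θ.hL' θ.b₀ θ.b₁ Mstar)
    (U : (bg9Y (Matrix (Fin N) (Fin N) ℂ) (specialUnitaryUnits (Fin N)) x).Cfg) (c : ι x) :
    (cubeOps39YF 𝔏 bI 𝒞 x).Cl U c = Cl39 x.toKIdx (𝔏 x).parS ((𝒞 x).D c) ((𝒞 x).Dblk c) U := rfl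

omit [∀ x : MemberY θ.d₆ θ.ℓ₆ θ.hd' θ.hL' θ.b₀ θ.b₁ Mstar, Fintype (geo9Y x).Site]
  [∀ x : MemberY θ.d₆ θ.ℓ₆ θ.hd' θ.hL' θ.b₀ θ.b₁ Mstar, DecidableEq (geo9Y x).Site] in
/-- ★★★ **THE LOCAL-INVERSE IDENTITIES OF THEOREM 3.9 HOLD AT THE GENUINE LETTERS, AT EVERY UNITARY BACKGROUND**: under the transporter pin
`(𝔏 x).parS = parSymY` and the inclusion «sites of the cube's blocks ⊆ the cube's sites», `Identities395Blk (cubeOps39YF …) U` for every `G`-valued `U`,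
`G ≤ U(N)` — ZERO analytic input. [cite: Balaban1985BackgroundPropagators, (3.87) p.409 + (3.95) p.411, Thm 3.11 p.416] -/
theorem identities395Blk_cubeOps39YF {G : Subgroup (Matrix (Fin N) (Fin N) ℂ)ˣ} (hG : G ≤ B7Prop2Explicit.unitaryUnits (Matrix (Fin N) (Fin N) ℂ))
    (x : MemberY θ.d₆ θ.ℓ₆ θ.hd' θ.hL' θ.b₀ θ.b₁ Mstar) (hparS : (𝔏 x).parS = parSymY x.toKIdx)
    (hDD : ∀ (c : ι x) (z : SiteY x.toKIdx), blkOf x.toKIdx.D.toDomains z ∈ (𝒞 x).Dblk c → z ∈ (𝒞 x).D c)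
    {U : (bg9Y (Matrix (Fin N) (Fin N) ℂ) (specialUnitaryUnits (Fin N)) x).Cfg} (hU : ∀ μ z, U μ z ∈ G) :
    Identities395Blk (cubeOps39YF 𝔏 bI 𝒞 x) U where
  inv := fun c => by
    rw [cubeOps39YF_Lloc, cubeOps39YF_Cl, hparS]
    exact Lloc39_mul_Cl39_parSymY x.toKIdx hG hU (hDD c)

end Instance

/-! ## §4 The displayed `h348` body from LOCAL (3.48), the (2.85)-smallness and the static cube data -/

section Face

open scoped Matrix.Norms.L2Operator
open B9Thm39ReadingFaithful B6GlobalChartV1 B6Ineq2142KLevelV1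

variable {N : ℕ} {θ : Stage3Params} {Mstar : ℕ} (𝔏 : LettersY N θ Mstar)
variable [∀ x : MemberY θ.d₆ θ.ℓ₆ θ.hd' θ.hL' θ.b₀ θ.b₁ Mstar, Fintype (geo9Y x).Site]
  [∀ x : MemberY θ.d₆ θ.ℓ₆ θ.hd' θ.hL' θ.b₀ θ.b₁ Mstar, DecidableEq (geo9Y x).Site]
variable (bI : ∀ x : MemberY θ.d₆ θ.ℓ₆ θ.hd' θ.hL' θ.b₀ θ.b₁ Mstar, FBondY x.toKIdx → IBondY x.toKIdx)
variable {ι : MemberY θ.d₆ θ.ℓ₆ θ.hd' θ.hL' θ.b₀ θ.b₁ Mstar → Type} [∀ x, Fintype (ι x)] (𝒞 : ∀ x, CubeData39 θ Mstar (ι x) x)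

/-- ★★★ **ROWS 15–16 BY PRINT's ROAD — THE DISPLAYED `h348` BODY FROM THE LOCAL SCHEMAS**: at a member `x` and a `G`-valued `U` (`G ≤ U(N)`), with the
transporter pin and the block∕site inclusion of the cubes, the static cube data `StaticOK39Blk (cubeOps39YF …) Ncnt` (partition of unity, overlap count,
geometry), [4] Lemma 2.1 `Ineq261With c′ … r α′`, LOCAL (3.48) for the genuine `C_□(U)` (`Local348Blk`), the (2.85)-smallness of (3.95)'s `R` (`Small285Blk`)
and «M sufficiently large» (`2θ₀c′ ≤ M`) give `Conv348Blk (oneCubeOps39YF θ M⋆ 𝔏 bI x) (2(Ncnt·B₀)c′) ((1 − α′)r) U` — (3.96) ⇒ (3.48) for the global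
`(Q′G′²Q′\*)⁻¹(U)` in the ONE display of the certificate. [cite: Balaban1985BackgroundPropagators, (3.95)–(3.96) p.411 + Thm 3.2 (3.48) p.398 + Thm 3.9 p.413; Balaban1984PropagatorsII, (2.83)–(2.87) p.238 + Lemma 2.1 (2.61) p.234] -/
theorem display348_of_local348_small285 {G : Subgroup (Matrix (Fin N) (Fin N) ℂ)ˣ}
    (hG : G ≤ B7Prop2Explicit.unitaryUnits (Matrix (Fin N) (Fin N) ℂ)) (x : MemberY θ.d₆ θ.ℓ₆ θ.hd' θ.hL' θ.b₀ θ.b₁ Mstar)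
    (hparS : (𝔏 x).parS = parSymY x.toKIdx)
    (hDD : ∀ (c : ι x) (z : SiteY x.toKIdx), blkOf x.toKIdx.D.toDomains z ∈ (𝒞 x).Dblk c → z ∈ (𝒞 x).D c)
    {c' r α' θ₀ B₀ δ₀ Ncnt : ℝ} (hc' : 0 ≤ c') (hr : 0 ≤ r) (hrδ : r ≤ δ₀) (hα' : α' ≤ 1) (hθ₀ : 0 ≤ θ₀) (hB₀ : 0 ≤ B₀)
    (hN : 0 ≤ Ncnt) (hM : 0 < (geo9Y x).M) (hMbig : 2 * θ₀ * c' ≤ (geo9Y x).M)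
    (hst : StaticOK39Blk (cubeOps39YF 𝔏 bI 𝒞 x) Ncnt) (h261 : Ineq261With c' (b6 (geo9Y x)) r α')
    {U : (bg9Y (Matrix (Fin N) (Fin N) ℂ) (specialUnitaryUnits (Fin N)) x).Cfg} (hU : ∀ μ z, U μ z ∈ G)
    (hloc : Local348Blk (cubeOps39YF 𝔏 bI 𝒞 x) B₀ δ₀ U) (hsmall : Small285Blk (cubeOps39YF 𝔏 bI 𝒞 x) θ₀ r U) :
    Conv348Blk (oneCubeOps39YF θ Mstar 𝔏 bI x) (2 * (Ncnt * B₀) * c') ((1 - α') * r) U :=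
  conv348Blk_of_pins (cubeOps39YF 𝔏 bI 𝒞 x) (oneCubeOps39YF θ Mstar 𝔏 bI x) (cubeOps39YF_L 𝔏 bI 𝒞 x).symm (cubeOps39YF_blk 𝔏 bI 𝒞 x).symm
    (conv348Blk_of_local348 (cubeOps39YF 𝔏 bI 𝒞 x) c' r α' θ₀ B₀ δ₀ Ncnt U hc' hr hrδ hα' hθ₀ hB₀ hN hM hMbig hst h261 hloc
      (identities395Blk_cubeOps39YF 𝔏 bI 𝒞 hG x hparS hDD hU) hsmall)

end Face

end Literature.MathematicalPhysics.QuantumFieldTheory.Balaban1983to89.B9Thm39CubeOpsAtLettersY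

end
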